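import Summits.PneNP.PneNP.Theorems.ChebyshevTracialDesignCrossingPinWeighted
import HarnessLib

/-!
# Cell pnp-psdrank, route `ChebyshevTracialDesign`: the TRACIAL crossing-pin lemma — a matrix-valued strategy pair supported on the cuts
# crossed by an edge and on the matchings containing it has design value `O(B·r·√P_{D−4})` in every dimension `r`

Harmonic backbone of the crux `TracialDecayExp20` (stmt-PneNP-19878), brick 24b (prover g7): the psd / all-`r` form of the crossing-pin lemma
(brick 23b `…CrossingPin.crossingPin_value_le`), i.e. the type-(I) pieces of planner p1's PSD-(N2) decomposition ("crossing-pinned window pattern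
⊗ arbitrary reduced sub-strategy", HOME/pnp-psdrank-p1/N2-SpreadStructure.md §CPD for PSD strategies). For `n` even, an exact design
`(n, t = 2c'+1, T, D, B, C, w)` with `4 ≤ D < t`, an edge `e = {a,b}`, and ANY `X : OddSet n → M_r(ℝ)`, `Y : PM_n → M_r(ℝ)` with `X_U = 0`
unless `e` crosses `U` and `Y_M = 0` unless `e ∈ M`:
* `crossingPin_tracial_value_le`: `|Σ_U Σ_M W(U,M)·tr(X_U Y_M)| ≤ (Σ_c|w_c|)·√(P_{D−4}·(Σ_{|U|=t}‖X_U‖_F²/C(n,t))·(Σ_M‖Y_M‖_F²/|PM|))`;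
* `crossingPin_tracial_value_le_of_contractions`: `≤ B·r·√P_{D−4}` when moreover `0 ⪯ X_U, Y_M ⪯ I_r`.
Entry by entry this is the weighted crossing-pin lemma (brick 24a) followed by brick 20's Cauchy–Schwarz over entry pairs. No tightness and
no junta/degree hypothesis on the strategy: ONE common crossing pin in index space makes the virtual value vanish at every dimension.
[cite: Rothvoss2017, §2 and Lemma 7 (PDF pp. 6–8)] [cite: Grigoriev2001, §1 and Lemma 1.4 (PDF p. 8)] [cite: GriblingDelaatLaurent2019, §5]
Stature: support/instrument. WHAT THIS IS NOT: not the psd structure theorem (which would say that every tight psd strategy decomposes into such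
pieces and low-degree factors), nothing on psd rank by itself, no P-vs-NP content. Supports stmt-PneNP-19878.
-/

set_option linter.dupNamespace false -- `Summit.PneNP.PneNP.…`: summit = sub-problem (D-0017)

noncomputable section

namespace Summit.PneNP.PneNP.Theorems.ChebyshevTracialDesignCrossingPinTracial

open Finset Matrix Literature.Barriers.PneNP Literature.Combinatorics.Optimization Literature.Computability.Complexity
open Literature.Combinatorics.SimpleGraph.CycleSpace
open Literature.Combinatorics.AssociationSchemes Literature.Combinatorics.AssociationSchemes.JohnsonHarmonics
open Summit.PneNP.PneNP.Theorems.ChebyshevTracialDesignLevelTail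
open Summit.PneNP.PneNP.Theorems.ChebyshevTracialDesignProfilePolynomial
open Summit.PneNP.PneNP.Theorems.ChebyshevTracialDesignTracialProfilePolynomial
open Summit.PneNP.PneNP.Theorems.ChebyshevTracialDesignCrossingPinWeighted

variable {n : ℕ}

/-- **The tracial crossing-pin lemma.** For `n` even, an exact design `(n, t = 2c'+1, T, D, B, C, w)` with `4 ≤ D < t`, an edge `{a,b}`
and `X : OddSet n → M_r(ℝ)`, `Y : PM_n → M_r(ℝ)` with `X_U = 0` unless `{a,b}` crosses `U` and `Y_M = 0` unless `{a,b} ∈ M`: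
`|Σ_U Σ_M levelWeight(U,M)·tr(X_U Y_M)| ≤ (Σ_{c∈C}|w_c|)·√(P_{D−4}·(Σ_{|U|=t}‖X_U‖_F²/C(n,t))·(Σ_M‖Y_M‖_F²/|PM|))`.
[cite: Rothvoss2017, §2 and Lemma 7 (PDF pp. 6–8)] [cite: Grigoriev2001, Lemma 1.4 (PDF p. 8)] [cite: GriblingDelaatLaurent2019, §5] -/
theorem crossingPin_tracial_value_le {c' T D r : ℕ} {Bv : ℝ} {C : Finset ℕ} {w : ℕ → ℝ} (hn : Even n)
    (hdes : IsExactDesign n (2 * c' + 1) T D Bv C w) (hD : D ≤ 2 * c') (hD4 : 4 ≤ D) (a b : Fin n)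
    (X : OddSet n → Matrix (Fin r) (Fin r) ℝ) (Y : PMatch n → Matrix (Fin r) (Fin r) ℝ)
    (hX : ∀ U : OddSet n, ¬ Crosses U.1 s(a, b) → X U = 0) (hY : ∀ M : PMatch n, s(a, b) ∉ M.1 → Y M = 0) :
    |∑ U : OddSet n, ∑ M : PMatch n, levelWeight n (2 * c' + 1) C w U M * (X U * Y M).trace| ≤
      (∑ c ∈ C, |w c|) *
        Real.sqrt ((∏ i ∈ range ((D - 4) / 2 + 1), ((2 * i + 1 : ℝ) / ((n : ℝ) - 2 * i))) *
          ((∑ U : OddSet n, if U.1.card = 2 * c' + 1 then ∑ a, ∑ b, X U a b ^ 2 else 0) / (n.choose (2 * c' + 1) : ℝ)) *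
          ((∑ M : PMatch n, ∑ a, ∑ b, Y M a b ^ 2) / (Fintype.card (PMatch n) : ℝ))) := by
  classical
  have htodd : Odd (2 * c' + 1) := ⟨c', rfl⟩
  have ht : 2 * (2 * c' + 1) + 2 ≤ n := hdes.2.1
  -- entry test functions on the `t`-subsets and their weights
  set f : Fin r × Fin r → Finset (Fin n) → ℝ := fun ab U =>
    if h : U.card = 2 * c' + 1 then X ⟨U, ⟨c', h⟩⟩ ab.1 ab.2 else 0 with hf
  set y : Fin r × Fin r → PMatch n → ℝ := fun ab M => Y M ab.2 ab.1 with hy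
  have hhom : ∀ ab, IsHomog (2 * c' + 1) (f ab) := fun ab U hU => by
    simp only [hf, dif_neg hU]
  have hfX : ∀ ab (U : OddSet n), U.1.card = 2 * c' + 1 → f ab U.1 = X U ab.1 ab.2 := fun ab U hU => by
    simp only [hf, dif_pos hU]
  have hfχ : ∀ ab (U : Finset (Fin n)), ¬ Crosses U s(a, b) → f ab U = 0 := by
    intro ab U hU
    by_cases hc : U.card = 2 * c' + 1
    · simp only [hf, dif_pos hc, hX ⟨U, ⟨c', hc⟩⟩ hU, Matrix.zero_apply]
    · simp only [hf, dif_neg hc]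
  have hyY : ∀ ab (M : PMatch n), s(a, b) ∉ M.1 → y ab M = 0 := fun ab M hM => by
    simp only [hy, hY M hM, Matrix.zero_apply]
  -- per entry pair: the weighted crossing-pin lemma (brick 24a)
  have H := fun ab => crossingPin_weighted_value_le hn hdes hD hD4 a b (f ab) (hhom ab) (hfχ ab) (y ab) (hyY ab)
  -- the value splits over the entry pairs (the weight vanishes off the `t`-cuts)
  have hval : ∑ U : OddSet n, ∑ M : PMatch n, levelWeight n (2 * c' + 1) C w U M * (X U * Y M).trace =
      ∑ ab : Fin r × Fin r, ∑ U : OddSet n, ∑ M : PMatch n, levelWeight n (2 * c' + 1) C w U M * (f ab U.1 * y ab M) := by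
    rw [sum_comm (s := (univ : Finset (Fin r × Fin r)))]
    refine sum_congr rfl fun U _ => ?_
    rw [sum_comm (s := (univ : Finset (Fin r × Fin r)))]
    refine sum_congr rfl fun M _ => ?_
    by_cases hU : U.1.card = 2 * c' + 1
    · rw [trace_mul_eq_sum_pairs, mul_sum]
      exact sum_congr rfl fun ab _ => by rw [hfX ab U hU]
    · have h0 : levelWeight n (2 * c' + 1) C w U M = 0 := by
        rw [levelWeight]
        exact sum_eq_zero fun c _ => by rw [if_neg (fun h => hU (mem_Qset_iff.1 h).1)]
      simp only [h0, zero_mul, sum_const_zero]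
  -- the Frobenius sums, re-indexed
  have hNX : ∑ ab : Fin r × Fin r, ∑ U ∈ univ.powersetCard (2 * c' + 1), f ab U ^ 2 =
      ∑ U : OddSet n, (if U.1.card = 2 * c' + 1 then ∑ a, ∑ b, X U a b ^ 2 else 0) := by
    rw [sum_comm, ← sum_oddSet_card_eq htodd (fun U => ∑ ab : Fin r × Fin r, f ab U ^ 2)]
    refine sum_congr rfl fun U _ => ?_
    split_ifs with hU
    · rw [Fintype.sum_prod_type]
      exact sum_congr rfl fun a _ => sum_congr rfl fun b _ => by rw [hfX (a, b) U hU]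
    · rfl
  have hNY : ∑ ab : Fin r × Fin r, ∑ M : PMatch n, y ab M ^ 2 = ∑ M : PMatch n, ∑ a, ∑ b, Y M a b ^ 2 := by
    rw [sum_comm]
    refine sum_congr rfl fun M _ => ?_
    rw [Fintype.sum_prod_type]
    exact sum_comm
  have hPD : 0 ≤ ∏ i ∈ range ((D - 4) / 2 + 1), ((2 * i + 1 : ℝ) / ((n : ℝ) - 2 * i)) :=
    prod_atten_nonneg (n := n) (K := D - 4) (by omega)
  have hw0 : 0 ≤ ∑ c ∈ C, |w c| := sum_nonneg fun c _ => abs_nonneg _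
  rw [hval]
  refine (abs_sum_le_sum_abs _ _).trans ((sum_le_sum fun ab _ => H ab).trans ?_)
  rw [← mul_sum]
  refine mul_le_mul_of_nonneg_left ?_ hw0
  refine (sum_sqrt_tail_le univ hPD
    (fun ab => (∑ U ∈ univ.powersetCard (2 * c' + 1), f ab U ^ 2) / (n.choose (2 * c' + 1) : ℝ))
    (fun ab => (∑ M : PMatch n, y ab M ^ 2) / (Fintype.card (PMatch n) : ℝ))
    (fun ab => by positivity) (fun ab => by positivity)).trans ?_
  rw [← sum_div, ← sum_div, hNX, hNY]

/-- **The tracial crossing-pin lemma for contractions**: under the hypotheses of `crossingPin_tracial_value_le`, if moreover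
`0 ⪯ X_U ⪯ I_r` and `0 ⪯ Y_M ⪯ I_r`, then `|Σ_U Σ_M levelWeight(U,M)·tr(X_U Y_M)| ≤ B·r·√P_{D−4}` — in normalised form the tracial value is
`≤ B·√P_{D−4}`, independently of the dimension. [cite: Rothvoss2017, §2 (PDF pp. 6–8)] [cite: GriblingDelaatLaurent2019, §5] -/
theorem crossingPin_tracial_value_le_of_contractions {c' T D r : ℕ} {Bv : ℝ} {C : Finset ℕ} {w : ℕ → ℝ} (hn : Even n)
    (hdes : IsExactDesign n (2 * c' + 1) T D Bv C w) (hD : D ≤ 2 * c') (hD4 : 4 ≤ D) (a b : Fin n)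
    (X : OddSet n → Matrix (Fin r) (Fin r) ℝ) (Y : PMatch n → Matrix (Fin r) (Fin r) ℝ)
    (hX : ∀ U : OddSet n, ¬ Crosses U.1 s(a, b) → X U = 0) (hY : ∀ M : PMatch n, s(a, b) ∉ M.1 → Y M = 0)
    (hXc : ∀ U, (X U).PosSemidef ∧ (1 - X U).PosSemidef) (hYc : ∀ M, (Y M).PosSemidef ∧ (1 - Y M).PosSemidef) :
    |∑ U : OddSet n, ∑ M : PMatch n, levelWeight n (2 * c' + 1) C w U M * (X U * Y M).trace| ≤
      Bv * ((r : ℝ) * Real.sqrt (∏ i ∈ range ((D - 4) / 2 + 1), ((2 * i + 1 : ℝ) / ((n : ℝ) - 2 * i)))) := by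
  have ht : 2 * (2 * c' + 1) + 2 ≤ n := hdes.2.1
  have hB := hdes.2.2.2.2.2.2
  have hPm : (0 : ℝ) < Fintype.card (PMatch n) := by exact_mod_cast card_pmatch_pos hn
  have hCn : (0 : ℝ) < n.choose (2 * c' + 1) := by exact_mod_cast Nat.choose_pos (by omega)
  have hPD := prod_atten_nonneg (n := n) (K := D - 4) (by omega)
  have hw0 : 0 ≤ ∑ c ∈ C, |w c| := sum_nonneg fun c _ => abs_nonneg _
  have htail := sqrt_tail_le_of_le hPD hCn hPm (Nat.cast_nonneg r)
    (sum_nonneg fun M _ => by positivity) (sum_frobenius_cuts_le ⟨c', rfl⟩ hXc) (sum_frobenius_matchings_le hYc)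
  exact (crossingPin_tracial_value_le hn hdes hD hD4 a b X Y hX hY).trans (mul_le_mul hB htail (Real.sqrt_nonneg _) (hw0.trans hB))

end Summit.PneNP.PneNP.Theorems.ChebyshevTracialDesignCrossingPinTracial
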